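import Literature.AnabelianGeometry.SemiGraphs.TemperedAnabelian
import Literature.AnabelianGeometry.SemiGraphs.TemperedOrigin
import Mathlib.Topology.Algebra.Group.Quotient
import HarnessLib

/-!
# [SemiAnbd] Theorem 6.6 (Tempered and Profinite Outer Isomorphisms): the printed proof as a sub-DAG

Mochizuki, *Semi-graphs of anabelioids*, Publ. RIMS **42** (2006) [SemiAnbd], §6, Theorem 6.6,
author's manuscript p. 72 (statement) and pp. 72–73 (proof). [cite: MochizukiSemiAnbd2006, Thm 6.6 pp.72-73]

The node itself is typed in `TemperedAnabelian.lean` as the predicate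
`TemperedCurve.ProfiniteOuterIsoLifts X Y` on the curve-level interface `TemperedCurve p` (printed,
origin-guarded form: `TemperedOrigin.ProfiniteOuterIsoLiftsHolds`).  This file (abc-iut cell, human
ruling D-0068 (1) "statements-first sub-DAG"; plan file `plan/L3/SUBDAG-SemiAnbd-Thm66.md`, rows
L01–L09) cuts the PRINTED PROOF into intermediate statements over the same interface:

* **L01** `TemperedIsoCompletes` — "it is immediate that every outer isomorphism
  `Π^temp_{X_K} ⥲ Π^temp_{Y_L}` determines an outer isomorphism `Π_{X_K} ⥲ Π_{Y_L}`" (p. 72).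
* **L02–L07** `SpecializationIsoSystem X Y α̂` — the DATA the proof attaches to an isomorphism
  `α̂ : Π_{X_K} ⥲ Π_{Y_L}`: corresponding open normal subgroups `H_X`, `H_Y` (L02; a cofinal decreasing
  sequence of them, the index set of the inverse limit), the closed normal subgroups
  `J_X ⊆ H_X ∩ Δ^temp_X`, `J_Y ⊆ H_Y ∩ Δ^temp_Y` "determined by the pro-tempered coverings arising from
  the tempered coverings [§3] of `𝒢^c_{H_X}`, `𝒢^c_{H_Y}`" (L04), the isomorphisms
  `β_H : Π^temp_{X_K}/J_X ⥲ Π^temp_{Y_L}/J_Y` induced via `Π^temp/J ⥲ π₁^temp(𝒢^c_H) ⋊^out H′` by the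
  [Mzk3] Lemma 2.3 specialisation isomorphisms `α̂_H : 𝒢^c_{H_X} ⥲ 𝒢^c_{H_Y}` (L03, L05, L06), the fact
  that "the profinite completion `β̂_H` differs from the isomorphism `Π_{X_K}/J_X^∧ ⥲ Π_{Y_L}/J_Y^∧`
  induced by `α̂` by composition with an inner automorphism" (L06, field `underHat`), their
  compatibility "up to inner automorphism" as `H` varies (L07, Ex. 5.6 / Rmk. 5.6.1; field
  `compat`), and the limit properties `Π^temp = lim_H Π^temp/J_X(H)` (L05/L08: fields `initial_*`,
  `complete_*`).  The GEOMETRIC inputs ([Mzk3] = [AbsAnab] Lem. 2.3, [SemiAnbd] §3, Ex. 5.6) are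
  FACT-policy in the cell and are not in the tree at curve level (their one-base-field twins are
  `Rmk561RigidityStatement`, `Ex56CompactRigidityStatement` of `ArithmeticCurves.lean`); hence the
  EXISTENCE of such a system is recorded as ONE origin-guarded statement
  `TemperedOrigin.SpecializationIsoSystemHolds` (never asserted), exactly like the other §6 rows.
* **L08** (GROUP THEORY, PROVED in the companion `TemperedAnabelianThm66SubProofs.lean`): "by
  passing to the corresponding inverse limit, … the various `β_H` determine an isomorphism
  `β : Π^temp_{X_K} ⥲ Π^temp_{Y_L}` whose profinite completion differs from `α̂` by an inner automorphism"
  — `SpecializationIsoSystem.exists_liesUnder`, from the abstract theorem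
  `QuotientIsoSystemLift.exists_continuousMulEquiv_liesUnder` (`QuotientIsoSystemLift.lean`).
* **L09** (GROUP THEORY, PROVED in the companion): "That such a `β` is unique, up to inner
  automorphism, follows from Lemma 6.1, (iii)" — `liesUnder_unique_of_piTempNormallyTerminal`.
* **Assembly** (companion): `profiniteOuterIsoLifts_of_system : (∀ α̂, Nonempty
  (SpecializationIsoSystem X Y α̂)) → Y.PiTempNormallyTerminal → X.ProfiniteOuterIsoLifts Y`, and the
  origin-guarded form `TemperedOrigin.profiniteOuterIsoLiftsHolds_of`.

This file holds the STATEMENTS only (definitions, the structure, and the `Iff.rfl` unfolding of the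
node); all proofs are in `TemperedAnabelianThm66SubProofs.lean`.

Honest framing: every intermediate statement is OUR paraphrase of a printed sentence, typed over
abstract data; typed ≠ proved; the node stays FACT-policy (campaign M) — what is kernel-closed here
is the purely group-theoretic part of the printed proof.  Nothing in this file concerns the disputed
parts of inter-universal Teichmüller theory or takes a side on [IUTchIII] Cor. 3.12.
-/

noncomputable section

namespace Literature.AnabelianGeometry.SemiGraphs

open _root_.Topology

namespace TemperedCurve

variable {p : ℕ} [Fact p.Prime]

/-! ### L01: the trivial direction -/

/-- **[SemiAnbd] Thm 6.6, proof, first sentence** (p. 72): "it is immediate that every outer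
isomorphism `Π^temp_{X_K} ⥲ Π^temp_{Y_L}` determines an outer isomorphism `Π_{X_K} ⥲ Π_{Y_L}`" — every
isomorphism of the tempered groups extends along `ι_X`, `ι_Y` to an isomorphism of the profinite
completions (universal property of the profinite completion).  Sub-DAG row L01; a classical
statement about `IsProfiniteCompletion`, typed here, not proved here.
[cite: MochizukiSemiAnbd2006, Thm 6.6 proof p.72] -/
def TemperedIsoCompletes (X Y : TemperedCurve p) : Prop :=
  ∀ β : X.PiTemp ≃ₜ* Y.PiTemp, ∃ αhat : X.PiHat ≃ₜ* Y.PiHat, ∀ g : X.PiTemp,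
    αhat (X.toHat g) = Y.toHat (β g)

/-- "`β̂` differs from `α̂` by an inner automorphism" (p. 72/73): the tempered isomorphism `β` LIES
UNDER the profinite isomorphism `α̂`, i.e. `α̂ ∘ ι_X = Inn(c) ∘ ι_Y ∘ β` for some `c ∈ Π_{Y_L}` — the
relation of which `ProfiniteOuterIsoLifts` asserts existence and uniqueness up to `Inn(Π^temp_{Y_L})`.
[cite: MochizukiSemiAnbd2006, Thm 6.6 p.72] -/
def LiesUnder (X Y : TemperedCurve p) (αhat : X.PiHat ≃ₜ* Y.PiHat) (β : X.PiTemp ≃ₜ* Y.PiTemp) :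
    Prop :=
  ∃ c : Y.PiHat, ∀ g : X.PiTemp, αhat (X.toHat g) = c * Y.toHat (β g) * c⁻¹

/-- `ProfiniteOuterIsoLifts` (the typed Thm 6.6) unfolds to: every `α̂` has a `β` lying under it,
unique up to an inner automorphism of `Π^temp_{Y_L}`. [cite: MochizukiSemiAnbd2006, Thm 6.6 p.72] -/
theorem profiniteOuterIsoLifts_iff (X Y : TemperedCurve p) :
    X.ProfiniteOuterIsoLifts Y ↔ ∀ αhat : X.PiHat ≃ₜ* Y.PiHat,
      (∃ β : X.PiTemp ≃ₜ* Y.PiTemp, LiesUnder X Y αhat β) ∧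
        ∀ β β' : X.PiTemp ≃ₜ* Y.PiTemp, LiesUnder X Y αhat β → LiesUnder X Y αhat β' →
          ∃ y : Y.PiTemp, ∀ g : X.PiTemp, β' g = y * β g * y⁻¹ :=
  Iff.rfl

/-! ### L02–L07: the specialisation isomorphism system attached to `α̂` -/

/-- **[SemiAnbd] Thm 6.6, proof, pp. 72–73 — the data attached to `α̂ : Π_{X_K} ⥲ Π_{Y_L}`**
(sub-DAG rows L02–L07 with the limit properties used in L08), over the curve-level interface:
* (L02) "Let `H_X ⊆ Π_{X_K}`, `H_Y ⊆ Π_{Y_L}` be open normal subgroups [of finite index] that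
  correspond via `α̂`" — a decreasing, cofinal SEQUENCE `HX n` of them (the index set of the
  inverse limit of p. 73) and `HY n = α̂(HX n)`;
* (L04) "the closed subgroups `J_X ⊆ H_X ∩ Δ^temp_X ⊆ Δ^temp_X`, `J_Y ⊆ H_Y ∩ Δ^temp_Y` determined by
  considering the pro-tempered coverings of `X_K̄`, `Y_K̄` arising from the various tempered coverings
  [cf. §3] of `𝒢^c_{H_X}`, `𝒢^c_{H_Y}`" [`𝒢^c_H` = the semi-graph of anabelioids with compact structure
  of the geometric special fibre of the covering `H`, Example 2.10; [Mzk3] Appendix] — normal (the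
  quotient `Π^temp_{X_K}/J_X` is a group, p. 73) and closed;
* (L03, L05, L06) the isomorphisms `β_H : Π^temp_{X_K}/J_X ⥲ Π^temp_{Y_L}/J_Y` — in print the
  composite of "natural isomorphisms `Π^temp_{X_K}/J_X ⥲ π₁^temp(𝒢^c_{H_X}) ⋊^out H′_X`" with the
  isomorphism induced by the [Mzk3] Lemma 2.3 specialisation isomorphism `α̂_H : 𝒢^c_{H_X} ⥲ 𝒢^c_{H_Y}`
  and `α̂_{H′} : H′_X ⥲ H′_Y` (`H′ := Π/(H ∩ Δ)`); recorded by their OUTPUT `β n` (the semi-graphs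
  `𝒢^c_H` are not in the tree at curve level);
* (L06) "the functoriality of the construction of `α̂_H` in [Mzk3], Lemma 2.3, implies that the
  profinite completion `β̂_H` differs from the isomorphism `Π_{X_K}/J_X^∧ ⥲ Π_{Y_L}/J_Y^∧` induced by `α̂`
  by composition with an inner automorphism" [`∧` = closure in `Π`] — field `underHat`;
* (L07) "as one varies `H_X`, `H_Y`, consideration of the resulting generalized morphisms of
  arithmetic graphs of anabelioids [Example 5.6, Remark 5.6.1] shows that the resulting `β_H`'s are
  compatible [up to inner automorphism]" — field `compat` (consecutive levels);
* (L05/L08) `Π^temp = lim_H Π^temp/J(H)` as topological groups ("passing to the corresponding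
  inverse limit", p. 73; from temperedness): fields `initial_JX/JY` (the topology of `Π^temp` is
  initial for the quotient maps) and `complete_JX/JY` (coherent sequences of cosets come from
  elements).
INTERFACE BOUNDARY: the construction of this data from `α̂` is [Mzk3] = [AbsAnab] Lem. 2.3 +
[SemiAnbd] §3 + Ex. 5.6 / Rmk. 5.6.1 (FACT-policy in the cell; one-base-field twins
`Rmk561RigidityStatement`, `Ex56CompactRigidityStatement` in `ArithmeticCurves.lean`) — recorded as
the origin-guarded statement `TemperedOrigin.SpecializationIsoSystemHolds`, never constructed here
-- TODO-merge: abc-iut-L3-t2 / t3 (special-fibre towers `StableReductionTower` ↔ `TemperedCurve`).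
[cite: MochizukiSemiAnbd2006, Thm 6.6 proof pp.72-73] -/
structure SpecializationIsoSystem (X Y : TemperedCurve p) (αhat : X.PiHat ≃ₜ* Y.PiHat) : Type where
  /-- (L02) the open normal subgroups `H_X ⊆ Π_{X_K}` (a cofinal decreasing sequence) -/
  HX : ℕ → Subgroup X.PiHat
  isOpen_HX : ∀ n, IsOpen (HX n : Set X.PiHat)
  normal_HX : ∀ n, (HX n).Normal
  antitone_HX : Antitone HX
  /-- cofinality: every neighbourhood of `1` in `Π_{X_K}` contains some `H_X` -/
  cofinal_HX : ∀ U : Set X.PiHat, IsOpen U → (1 : X.PiHat) ∈ U → ∃ n, (HX n : Set X.PiHat) ⊆ U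
  /-- (L02) `H_Y ⊆ Π_{Y_L}` "correspond[ing] via `α̂`" -/
  HY : ℕ → Subgroup Y.PiHat
  HY_eq : ∀ n, HY n = (HX n).map αhat.toMulEquiv.toMonoidHom
  /-- (L04) the closed normal subgroups `J_X ⊆ Π^temp_{X_K}` -/
  JX : ℕ → Subgroup X.PiTemp
  /-- (L04) the closed normal subgroups `J_Y ⊆ Π^temp_{Y_L}` -/
  JY : ℕ → Subgroup Y.PiTemp
  [normal_JX : ∀ n, (JX n).Normal]
  [normal_JY : ∀ n, (JY n).Normal]
  isClosed_JX : ∀ n, IsClosed (JX n : Set X.PiTemp)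
  isClosed_JY : ∀ n, IsClosed (JY n : Set Y.PiTemp)
  antitone_JX : Antitone JX
  antitone_JY : Antitone JY
  /-- (L04) "`J_X ⊆ H_X ∩ Δ^temp_X`" -/
  JX_le : ∀ n, JX n ≤ (HX n).comap X.toHat.toMonoidHom ⊓ X.DeltaTemp
  /-- (L04) "`J_Y ⊆ H_Y ∩ Δ^temp_Y`" -/
  JY_le : ∀ n, JY n ≤ (HY n).comap Y.toHat.toMonoidHom ⊓ Y.DeltaTemp
  /-- (L05/L08) the topology of `Π^temp_{X_K}` is initial for the maps `Π^temp_{X_K} → Π^temp_{X_K}/J_X` -/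
  initial_JX : ∀ U : Set X.PiTemp, IsOpen U → (1 : X.PiTemp) ∈ U →
    ∃ n, ∃ W : Set (X.PiTemp ⧸ JX n), IsOpen W ∧ ((1 : X.PiTemp) : X.PiTemp ⧸ JX n) ∈ W ∧
      QuotientGroup.mk ⁻¹' W ⊆ U
  initial_JY : ∀ U : Set Y.PiTemp, IsOpen U → (1 : Y.PiTemp) ∈ U →
    ∃ n, ∃ W : Set (Y.PiTemp ⧸ JY n), IsOpen W ∧ ((1 : Y.PiTemp) : Y.PiTemp ⧸ JY n) ∈ W ∧
      QuotientGroup.mk ⁻¹' W ⊆ U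
  /-- (L05/L08) completeness of `Π^temp_{X_K}` for the system `J_X` -/
  complete_JX : ∀ s : ℕ → X.PiTemp, (∀ n, (s n)⁻¹ * s (n + 1) ∈ JX n) →
    ∃ t : X.PiTemp, ∀ n, t⁻¹ * s n ∈ JX n
  complete_JY : ∀ s : ℕ → Y.PiTemp, (∀ n, (s n)⁻¹ * s (n + 1) ∈ JY n) →
    ∃ t : Y.PiTemp, ∀ n, t⁻¹ * s n ∈ JY n
  /-- (L06) the isomorphisms `β_H : Π^temp_{X_K}/J_X ⥲ Π^temp_{Y_L}/J_Y` induced by `α̂_H`, `α̂_{H′}` -/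
  β : ∀ n, X.PiTemp ⧸ JX n ≃ₜ* Y.PiTemp ⧸ JY n
  /-- (L06) "`β̂_H` differs from the isomorphism `Π_{X_K}/J_X^∧ ⥲ Π_{Y_L}/J_Y^∧` induced by `α̂` by
  composition with an inner automorphism": for some `e ∈ Π_{Y_L}` and every `g`, every lift `y` of
  `β_H[g]`, `α̂(ι_X g) ≡ e · ι_Y(y) · e⁻¹` modulo `J_Y^∧ = closure of ι_Y(J_Y)` -/
  underHat : ∀ n, ∃ e : Y.PiHat, ∀ (g : X.PiTemp) (y : Y.PiTemp),
    β n (g : X.PiTemp ⧸ JX n) = (y : Y.PiTemp ⧸ JY n) →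
      (e * Y.toHat y * e⁻¹)⁻¹ * αhat (X.toHat g) ∈
        ((JY n).map Y.toHat.toMonoidHom).topologicalClosure
  /-- (L07) "the resulting `β_H`'s are compatible [up to inner automorphism]": for consecutive
  levels, `β_{H_n}[g] = [c] · (image of β_{H_{n+1}}[g]) · [c]⁻¹` for some `c ∈ Π^temp_{Y_L}` -/
  compat : ∀ n, ∃ c : Y.PiTemp, ∀ (g : X.PiTemp) (y y' : Y.PiTemp),
    β (n + 1) (g : X.PiTemp ⧸ JX (n + 1)) = (y' : Y.PiTemp ⧸ JY (n + 1)) →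
      β n (g : X.PiTemp ⧸ JX n) = (y : Y.PiTemp ⧸ JY n) → (c * y * c⁻¹)⁻¹ * y' ∈ JY n

end TemperedCurve

namespace TemperedOrigin

variable {p : ℕ} [Fact p.Prime]

/-- **Rows L02–L07 as ONE origin-guarded statement** ([SemiAnbd] Thm 6.6 proof pp. 72–73 via
[Mzk3] Lem. 2.3, §3, Ex. 5.6 / Rmk. 5.6.1): for hyperbolic curves `X_K`, `Y_L` over finite extensions
of `ℚ_p`, every isomorphism `α̂ : Π_{X_K} ⥲ Π_{Y_L}` of profinite fundamental groups carries a
specialisation isomorphism system.  FACT-policy (the geometric inputs are not in the tree); asserted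
only for certified `X`, `Y`; never constructed here. [cite: MochizukiSemiAnbd2006, Thm 6.6 proof pp.72-73] -/
def SpecializationIsoSystemHolds (Ω : TemperedOrigin p) : Prop :=
  ∀ X Y : TemperedCurve p, Ω.IsHyperbolicCurveOrigin X → Ω.IsHyperbolicCurveOrigin Y →
    ∀ αhat : X.PiHat ≃ₜ* Y.PiHat, Nonempty (TemperedCurve.SpecializationIsoSystem X Y αhat)

end TemperedOrigin

end Literature.AnabelianGeometry.SemiGraphs

end
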